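import Summits.ValiantsHypothesis.ValiantsHypothesis.Theorems.SymPencilPerFourInnerRankKernelForm
import Summits.ValiantsHypothesis.ValiantsHypothesis.Theorems.SymPencilPerFourInnerRankGenericAlt

/-!
# Route `SymPencil` — inner rank of the `2 | 2` row split of `per_4`: under (iA) the `y₂`-block
# of the `a`-part has a common image line or is of column type
# (`--supports` stmt-ValiantsHypothesis-5674 `SdcSuperquadratic`; (8,8) column, isotropic-kernel
# route, step (B5)(iii) of memo `NOTE-p6g15-5674-IR12-reduction.md` §10)

**Theorem** (`firstForm_or_column`).  Let `Σ_r c_r t_r((a,b),(y₂,y₃))² = per (a; b; y₂; y₃)`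
with `|ι| ≤ 11` squares and non-zero weights, and assume (iA): every `A₂(a) : y₂ ↦
(t_r((a,0),(y₂,0)))_r` has rank `≤ 1`.  Then EITHER all `A₂(a)y₂` lie on one line `K v₀`
(FIRST / normal form), OR for some coordinate `k` all columns `j ≠ k` of all `A₂(a)` vanish
(`t_r((a,0),(e_j,0)) = 0`; the column type, = hypothesis `hcols` of
`MixedKillTwo.false_of_mixedII`).

Proof: `RankOne.rank_one_family` gives the line or a common kernel hyperplane `ker φ`; if `ker φ`
contains a vector with non-zero coordinates, `KernelForm.iY₂_of_kernel_form` gives (iY₂), and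
(iY₂) at a vector `x₁ ∉ ker φ` makes `a ↦ A₂(a)x₁` rank `≤ 1`, whence the line; otherwise every
vector of `ker φ` has a zero coordinate, so (`GenericAlt.exists_forall_vanish`) one coordinate
vanishes on `ker φ`, i.e. `ker φ = {x_k = 0}`.  Honest framing: a step in a conditional reduction
of the cells `(8,8,10)`, `(8,8,11)`; nothing about the window, the crux or `VP ≠ VNP`.  No
definitions, no named facts. [folklore]
-/

noncomputable section

-- single-conjunct layout: Sub = Summit, duplicated namespace component intended
set_option linter.dupNamespace false

namespace Summit.ValiantsHypothesis.ValiantsHypothesis.Theorems.SymPencilPerFourInnerRankFirstForm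

open Matrix Finset Module
open Summit.ValiantsHypothesis.ValiantsHypothesis.Theorems.SymPencilPerFourPairingDiscTools
open Summit.ValiantsHypothesis.ValiantsHypothesis.Theorems.SymPencilPerFourInnerRankGenericAlt
open Summit.ValiantsHypothesis.ValiantsHypothesis.Theorems.SymPencilPerFourInnerRankRankOne
open Summit.ValiantsHypothesis.ValiantsHypothesis.Theorems.SymPencilPerFourInnerRankNotBoth
open Summit.ValiantsHypothesis.ValiantsHypothesis.Theorems.SymPencilPerFourInnerRankKernelForm

variable {K : Type*} [Field K] {ι : Type*} [Fintype ι]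

omit [Fintype ι] in
/-- A non-zero linear functional on `K⁴` whose kernel has no vector with all coordinates non-zero
is a multiple of a coordinate functional: its kernel is a coordinate hyperplane. [folklore] -/
theorem ker_eq_coord_of_forall_exists_zero [Infinite K] (φ : (Fin 4 → K) →ₗ[K] K) (hφ : φ ≠ 0)
    (h : ∀ y, φ y = 0 → ∃ i, y i = 0) : ∃ k : Fin 4, ∀ x : Fin 4 → K, x k = 0 → φ x = 0 := by
  classical
  -- one coordinate vanishes on all of `ker φ`
  obtain ⟨k, hk⟩ := exists_forall_vanish (LinearMap.ker φ) (A := Fin 4)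
    (fun k => ({fun y : Fin 4 → K => y k} : Set ((Fin 4 → K) → K)))
    (fun k f hf => by
      rw [Set.mem_singleton_iff.1 hf]
      exact fun y₀ y => linePoly_linear (LinearMap.proj k : (Fin 4 → K) →ₗ[K] K) y₀ y)
    (fun y hy => by
      obtain ⟨i, hi⟩ := h y (LinearMap.mem_ker.1 hy)
      exact ⟨i, fun f hf => by rw [Set.mem_singleton_iff.1 hf]; exact hi⟩)
  refine ⟨k, fun x hx => ?_⟩
  -- `ker φ ≤ ker (proj k)`, both of dimension `3`, hence equal
  have hle : LinearMap.ker φ ≤ LinearMap.ker (LinearMap.proj k : (Fin 4 → K) →ₗ[K] K) :=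
    fun y hy => by
      rw [LinearMap.mem_ker]
      exact hk y hy _ (Set.mem_singleton _)
  have hdim : ∀ ψ : (Fin 4 → K) →ₗ[K] K, ψ ≠ 0 → finrank K (LinearMap.ker ψ) = 3 := by
    intro ψ hψ
    have hr : LinearMap.range ψ = ⊤ := by
      rw [eq_top_iff]
      intro s _
      obtain ⟨x, hx⟩ : ∃ x, ψ x ≠ 0 := by
        by_contra hc; push Not at hc; exact hψ (LinearMap.ext hc)
      refine ⟨(s / ψ x) • x, ?_⟩
      rw [map_smul, smul_eq_mul]; field_simp
    have h := LinearMap.finrank_range_add_finrank_ker ψ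
    rw [hr, finrank_top, Module.finrank_self, finrank_fintype_fun_eq_card, Fintype.card_fin] at h
    omega
  have hproj : (LinearMap.proj k : (Fin 4 → K) →ₗ[K] K) ≠ 0 := fun h0 => by
    have := LinearMap.congr_fun h0 (Pi.single k 1)
    simp at this
  have heq : LinearMap.ker φ = LinearMap.ker (LinearMap.proj k : (Fin 4 → K) →ₗ[K] K) :=
    Submodule.eq_of_le_of_finrank_eq hle (by rw [hdim φ hφ, hdim _ hproj])
  have hxk : x ∈ LinearMap.ker (LinearMap.proj k : (Fin 4 → K) →ₗ[K] K) := by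
    rw [LinearMap.mem_ker]; exact hx
  rw [← heq, LinearMap.mem_ker] at hxk
  exact hxk

/-- **(iA) ⇒ common image line or column type.**  See the module docstring. [folklore] -/
theorem firstForm_or_column [CharZero K] [DecidableEq ι] (hι : Fintype.card ι ≤ 11)
    (c : ι → K) (hc : ∀ r, c r ≠ 0)
    (t : ι → (((Fin 4 → K) × (Fin 4 → K)) →ₗ[K] ((Fin 4 → K) × (Fin 4 → K)) →ₗ[K] K))
    (hJ : ∀ a b y₂ y₃ : Fin 4 → K,
      ∑ r, c r * (t r (a, b) (y₂, y₃)) ^ 2 = (Matrix.of ![a, b, y₂, y₃]).permanent)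
    (hA : ∀ (a x x' : Fin 4 → K) (r r' : ι),
      t r (a, 0) (x, 0) * t r' (a, 0) (x', 0) - t r (a, 0) (x', 0) * t r' (a, 0) (x, 0) = 0) :
    (∃ v₀ : ι → K, ∀ (a x : Fin 4 → K), ∃ s : K, (fun r => t r (a, 0) (x, 0)) = s • v₀) ∨
    (∃ k : Fin 4, ∀ j : Fin 4, j ≠ k → ∀ (a : Fin 4 → K) r, t r (a, 0) (Pi.single j 1, 0) = 0) := by
  classical
  -- the family as a bilinear map
  let M : (Fin 4 → K) →ₗ[K] (Fin 4 → K) →ₗ[K] (ι → K) :=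
    LinearMap.mk₂ K (fun a x => fun r => t r (a, 0) (x, 0))
      (fun a a' x => by
        funext r
        have : ((a + a', (0 : Fin 4 → K)) : (Fin 4 → K) × (Fin 4 → K)) = (a, 0) + (a', 0) := by
          simp
        simp only [this, map_add, LinearMap.add_apply, Pi.add_apply])
      (fun s a x => by
        funext r
        have : ((s • a, (0 : Fin 4 → K)) : (Fin 4 → K) × (Fin 4 → K)) = s • (a, 0) := by simp
        simp only [this, map_smul, LinearMap.smul_apply, Pi.smul_apply])
      (fun a x x' => by
        funext r
        have : ((x + x', (0 : Fin 4 → K)) : (Fin 4 → K) × (Fin 4 → K)) = (x, 0) + (x', 0) := by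
          simp
        simp only [this, map_add, Pi.add_apply])
      (fun s a x => by
        funext r
        have : ((s • x, (0 : Fin 4 → K)) : (Fin 4 → K) × (Fin 4 → K)) = s • (x, 0) := by simp
        simp only [this, map_smul, smul_eq_mul, Pi.smul_apply])
  have hM : ∀ a x r, M a x r = t r (a, 0) (x, 0) := fun a x r => rfl
  rcases rank_one_family M (fun a x x' r r' => by
      simp only [hM]; linear_combination hA a x x' r r') with ⟨v₀, hv₀⟩ | ⟨φ, hφ, hker⟩
  · exact Or.inl ⟨v₀, fun a x => hv₀ a x⟩
  have hker' : ∀ a x, φ x = 0 → ∀ r, t r (a, 0) (x, 0) = 0 := fun a x hx r => by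
    rw [← hM, hker a x hx]; rfl
  by_cases hnc : ∃ y₀ : Fin 4 → K, φ y₀ = 0 ∧ ∀ i, y₀ i ≠ 0
  · -- non-coordinate kernel: (iY₂), hence the common line
    obtain ⟨y₀, hy₀, hy₀'⟩ := hnc
    have hY := iY₂_of_kernel_form hι c hc t hJ φ hker' y₀ hy₀ hy₀'
    left
    obtain ⟨x₁, hx₁⟩ : ∃ x, φ x ≠ 0 := by
      by_contra h; push Not at h; exact hφ (LinearMap.ext h)
    -- `M a x = (φ x / φ x₁) • M a x₁`
    have hprop : ∀ a x, M a x = (φ x / φ x₁) • M a x₁ := by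
      intro a x
      have hz : φ (x - (φ x / φ x₁) • x₁) = 0 := by
        rw [map_sub, map_smul, smul_eq_mul]; field_simp; ring
      have := hker a _ hz
      rw [map_sub, map_smul] at this
      exact (sub_eq_zero.1 this)
    -- `a ↦ M a x₁` has rank ≤ 1 by (iY₂) at `x₁`
    by_cases hz1 : ∀ a, M a x₁ = 0
    · refine ⟨0, fun a x => ⟨0, ?_⟩⟩
      funext r; rw [← hM, hprop, hz1]; simp
    push Not at hz1
    obtain ⟨a₁, ha₁⟩ := hz1
    obtain ⟨r₁, hr₁⟩ : ∃ r, M a₁ x₁ r ≠ 0 := by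
      by_contra h; push Not at h; exact ha₁ (funext h)
    refine ⟨M a₁ x₁, fun a x => ?_⟩
    obtain ⟨s, hs⟩ := exists_smul_of_minors (M.flip x₁) (fun a a' r r' => by
      simp only [LinearMap.flip_apply, hM]; linear_combination hY x₁ a a' r r') a₁ r₁
      (by simpa [LinearMap.flip_apply] using hr₁) a
    simp only [LinearMap.flip_apply] at hs
    refine ⟨φ x / φ x₁ * s, ?_⟩
    funext r
    rw [← hM, hprop a x, hs, smul_smul]
  · -- coordinate kernel
    right
    push Not at hnc
    obtain ⟨k, hk⟩ := ker_eq_coord_of_forall_exists_zero φ hφ hnc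
    refine ⟨k, fun j hj a r => hker' a _ (hk _ ?_) r⟩
    simp [hj]

end Summit.ValiantsHypothesis.ValiantsHypothesis.Theorems.SymPencilPerFourInnerRankFirstForm

end
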